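import Mathlib.Analysis.Meromorphic.Basic
import Literature.NumberTheory.LFunctions.LandauOscillation
import HarnessLib

/-!
# Pólya's sign-change theorem (Grosswald 1967, Theorem B): sign changes of `f` versus the poles
# of `∫ f(x) x^{-s} dx` on its abscissa of holomorphy — NAMED FACT + the quantitative
# Pólya–Landau corollary (proved from the fact)

Topic `Literature/NumberTheory/LFunctions` (namespace `Literature.NumberTheory.LFunctions`, grouping
sub-namespace `PolyaSignChanges`). Cite item `wi-85833` (family rh, cell rh-split; consumer
`stmt-RiemannHypothesis-24464` = `ScrewPolyaSigns.PolyaLandauR`). Nothing in this file bears on the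
truth of RH.

## The printed statement (Grosswald, TAMS 126 (1967), §4, pp. 4–5 — held text read)

THEOREM A (Landau). Let `f(x)` be real and positive for `x ≥ x₀` and suppose that
`∫_{x₀}^∞ f(x) x^{-s} dx` has the finite abscissa of convergence `θ`; then `F(s)`, represented for
`σ > θ` by the integral, has a singularity at `s = θ`. (In the tree: `LandauOscillation.lean`,
`Landau.integrableOn_of_differentiableOn_union_convex`, proved.)
COROLLARY A. If `F(s) = ∫_{x₀}^∞ f(x) x^{-s} dx` with `f` real, the integral convergent in some
half-plane, `F` holomorphic for `σ > θ` but not in any half-plane `σ > θ − ε` (`ε > 0`), and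
`s = θ` a regular point of `F`, then `f` changes sign at all points of an infinite set `X = {xₙ}`,
`xₙ → +∞` (an X-set).
THEOREM B (Pólya [27]). Suppose `f` and `F` are as in Corollary A, and that `ε₀ > 0` is such that
`F` is meromorphic for `σ ≥ θ − ε₀`. Let `P` be the (possibly empty) set of poles `s = θ + it` of `F`
of abscissa `σ = θ`; `γ := min_{θ+it ∈ P} |t|` (`γ := +∞` if `P = ∅`). Then
`W(y) := #{xₙ ∈ X : xₙ ≤ y}` satisfies `limsup_{y→∞} W(y)/log y ≥ γ/π`.
Grosswald p. 5: Pólya's proof has a gap in the case `γ = +∞` only; the statement is correct even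
then (Steinig 1969, complete proof). [27] = Pólya 1930 (reprinted with an addendum 1969).

## How it is typed (faithfulness sheet)

* The transform is the tree's `Landau.mellinIoi g s = ∫_{(1,∞)} g(x) x^{-(s+1)} dx` (`x₀ = 1`,
  `g(x) = x f(x)`: the shift `s ↦ s+1` and the change of `f` on a bounded interval neither move
  the abscissa `θ` and the poles of the continuation nor change `limsup W/log`; sign changes of `f`
  and `g` on `(1, ∞)` coincide). "Convergent in some half-plane" is typed as INTEGRABILITY of
  `g(x) x^{-(σ₁+1)}` on `(1,∞)` for some `σ₁ ≥ θ` (a slightly stronger hypothesis than conditional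
  convergence — the fact asserts less than print, the safe direction).
* "F holomorphic for `σ > θ`, meromorphic for `σ ≥ θ − ε₀`" : a function `Φ : ℂ → ℂ`, meromorphic
  on the open half-plane `{θ − ε₀ < re}` (equivalent to print after halving `ε₀`), complex
  differentiable on `{θ < re}`, agreeing with `mellinIoi g` on `{σ₁ < re}`. "Not holomorphic in any
  half-plane `σ > θ − ε`": no complex-differentiable `Ψ` on `{θ − ε < re}` agrees with `mellinIoi g`
  on `{σ₁ < re}`, for every `ε > 0`.
* `γ` and "`s = θ` regular": the conclusion is stated for every HEIGHT `Γ > 0` such that `Φ` is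
  complex differentiable on an open box `{θ − η < re, |im| < Γ}` (`η > 0`) around the segment
  `{θ + it : |t| < Γ}` — i.e. for every `Γ ≤ γ` up to removable values of `Φ` (poles of a
  meromorphic function on an open half-plane are isolated, so `γ ≥ Γ` gives such a box for every
  `Γ' < Γ`, and conversely a pole-free box of half-height `Γ` forces `γ ≥ Γ`); the box contains
  `θ`, which is the regularity of `s = θ`. The case `P = ∅` (`γ = +∞`) is the statement for all `Γ`.
* `W(y)` and the `limsup`: sign changes are counted by ALTERNATING CHAINS
  (`HasSignChain g y n`: points `1 < x₀ < ⋯ < xₙ ≤ y` with `g(xᵢ) g(xᵢ₊₁) < 0`; a chain of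
  length `n` exhibits `≥ n` sign changes in `(1, y]` and `n` points of sign change give a chain of
  length `n`), and `limsup_{y→∞} W(y)/log y ≥ Γ/π` is spelled `∀ c < Γ/π, ∀ y₀, ∃ y ≥ y₀` with a
  chain of length `≥ c log y` in `(1, y]`.

## Contents

* `HasSignChain` (def) + unfolding lemmas; `Grosswald1967_thmB` — THE NAMED FACT (`def … : Prop`,
  not proved here: Pólya's proof (Landau's lemma + a counting argument for the poles nearest to the
  real axis; Steinig for `γ = ∞`) is an L-sized formalisation; the tree has Landau's lemma).
* PROVED from the fact: `Grosswald1967_thmB.exists_holomorphic_extension_of_chain_bound` — the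
  quantitative Pólya–Landau statement in the shape of the consumer `ScrewPolyaSigns.PolyaLandauR`:
  if every alternating chain of `g` in `(1, X]` has length `≤ D log X + B` and the continuation `Φ`
  (meromorphic on `{θ − b < re}`) is holomorphic on `{θ < re} ∪ {θ − η < re, |im| < πD + η}`, then
  `mellinIoi g` extends holomorphically to a half-plane `{θ − ε < re}`, `ε > 0` (contrapositive of
  Theorem B with `Γ = πD + η`: `limsup W/log ≥ D + η/π > D`).

## References

* E. Grosswald, *Oscillation theorems of arithmetical functions*, Trans. Amer. Math. Soc. 126 (1967)
  1–28, §4 Thm A, Cor A, Thm B (pp. 4–5), §7 Thm 1 and Remarks (pp. 8–9). [Grosswald1967] (held)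
* G. Pólya, *Über das Vorzeichen des Restgliedes im Primzahlsatz*, Gött. Nachr. (1930) 19–27,
  Satz III; reprint with addendum in *Number Theory and Analysis* (Plenum 1969), MR0263757.
  [Polya1930] (not held, acq-13600; statement taken from Grosswald)
* J. Steinig, *The changes of sign of certain arithmetical error-terms*, Comment. Math. Helv. 44
  (1969) 385–400, MR0257003 (the case `γ = +∞`). [Steinig1969] (not held, acq-13640)
* H. L. Montgomery, R. C. Vaughan, *Multiplicative Number Theory I*, §15.1 (Landau's lemma; tree
  file `LandauOscillation.lean`). [MontgomeryVaughan2007]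
-/

noncomputable section

open Complex Set MeasureTheory

namespace Literature.NumberTheory.LFunctions

namespace PolyaSignChanges

/-- **An alternating chain of length `n` of `g` in `(1, y]`**: points `1 < x₀ < x₁ < ⋯ < xₙ ≤ y`
with `g(xᵢ) · g(xᵢ₊₁) < 0` for `i < n` — it witnesses at least `n` sign changes of `g` in `(1, y]`
(Grosswald's counting function `W(y) ≥ n`), and conversely `n` points of sign change yield such a
chain. [cite: Grosswald1967, §4 Thm B (the counting function W(y) of the X-set of sign changes), p. 4] -/
def HasSignChain (g : ℝ → ℝ) (y : ℝ) (n : ℕ) : Prop :=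
  ∃ x : Fin (n + 1) → ℝ, StrictMono x ∧ (∀ i, x i ∈ Ioc 1 y) ∧
    ∀ i : Fin n, g (x i.castSucc) * g (x i.succ) < 0

/-- Unfolding of `HasSignChain`. [cite: Grosswald1967, §4 Thm B, p. 4] -/
theorem hasSignChain_iff (g : ℝ → ℝ) (y : ℝ) (n : ℕ) :
    HasSignChain g y n ↔ ∃ x : Fin (n + 1) → ℝ, StrictMono x ∧ (∀ i, x i ∈ Ioc 1 y) ∧
      ∀ i : Fin n, g (x i.castSucc) * g (x i.succ) < 0 := Iff.rfl

/-- A chain of length `0` exists as soon as `1 < y` (take the single point `y`).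
[cite: Grosswald1967, §4 Thm B, p. 4] -/
theorem hasSignChain_zero {g : ℝ → ℝ} {y : ℝ} (hy : 1 < y) : HasSignChain g y 0 :=
  ⟨fun _ => y, (fun a b h => absurd h (by rw [Fin.lt_def]; omega)), fun _ => ⟨hy, le_rfl⟩, fun i => i.elim0⟩

/-- Chains are monotone in the endpoint. [cite: Grosswald1967, §4 Thm B, p. 4] -/
theorem HasSignChain.mono {g : ℝ → ℝ} {y y' : ℝ} {n : ℕ} (h : HasSignChain g y n) (hy : y ≤ y') :
    HasSignChain g y' n := by
  obtain ⟨x, hx, hmem, hsign⟩ := h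
  exact ⟨x, hx, fun i => ⟨(hmem i).1, (hmem i).2.trans hy⟩, hsign⟩

/-- **NAMED FACT — Pólya's sign-change theorem in Grosswald's form (TAMS 126, Theorem B).** For a
real function `g` on `(1, ∞)` with `g(x) x^{-(σ₁+1)}` integrable, let `Φ` continue
`F = Landau.mellinIoi g` (`F(s) = ∫₁^∞ g(x) x^{-(s+1)} dx`) from `{σ₁ < re}`: `Φ` meromorphic on
`{θ − ε₀ < re}` (`ε₀ > 0`, `θ ≤ σ₁`), holomorphic on `{θ < re}`, and suppose `F` is holomorphic in
NO half-plane `{θ − ε < re}`, `ε > 0` (θ is the exact abscissa of holomorphy). Then for every height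
`Γ > 0` such that `Φ` is holomorphic on an open box `{θ − η < re, |im| < Γ}`, `η > 0` (no pole of
abscissa `θ` at height `< Γ`; `s = θ` regular) the sign changes of `g` satisfy
`limsup_{y→∞} W(y)/log y ≥ Γ/π`: for every `c < Γ/π` and every `y₀` there are `y ≥ y₀` and an
alternating chain of `g` in `(1, y]` of length `n ≥ c log y`. Printed with `γ = min |t|` over the
poles `θ + it` (`γ = +∞` if none): `limsup W(y)/log y ≥ γ/π`; see the module docstring for the
dictionary (box of half-height `Γ` ↔ `Γ ≤ γ`; chains ↔ `W`; `x₀ = 1`, `g = x·f`). Pólya 1930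
(gap for `γ = ∞` filled by Steinig 1969, Grosswald p. 5). NOT proved here.
[cite: Grosswald1967, §4 Theorem B (Pólya), pp. 4–5; Polya1930; Steinig1969] -/
def Grosswald1967_thmB : Prop :=
  ∀ (g : ℝ → ℝ) (σ₁ θ ε₀ : ℝ) (Φ : ℂ → ℂ),
    IntegrableOn (fun x : ℝ => g x * x ^ (-(σ₁ + 1))) (Ioi 1) →
    θ ≤ σ₁ → 0 < ε₀ →
    MeromorphicOn Φ {s : ℂ | θ - ε₀ < s.re} →
    DifferentiableOn ℂ Φ {s : ℂ | θ < s.re} →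
    EqOn Φ (Landau.mellinIoi g) {s : ℂ | σ₁ < s.re} →
    (∀ ε : ℝ, 0 < ε → ¬ ∃ Ψ : ℂ → ℂ, DifferentiableOn ℂ Ψ {s : ℂ | θ - ε < s.re} ∧
        EqOn Ψ (Landau.mellinIoi g) {s : ℂ | σ₁ < s.re}) →
    ∀ (Γ η : ℝ), 0 < Γ → 0 < η →
      DifferentiableOn ℂ Φ {s : ℂ | θ - η < s.re ∧ |s.im| < Γ} →
      ∀ c : ℝ, c < Γ / Real.pi → ∀ y₀ : ℝ, ∃ y : ℝ, y₀ ≤ y ∧ ∃ n : ℕ,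
        HasSignChain g y n ∧ c * Real.log y ≤ n

/-- **Quantitative Pólya–Landau from Theorem B** (the shape of the consumer
`ScrewPolyaSigns.PolyaLandauR`, PROVED from the named fact by contraposition): let `g` be real on
`(1,∞)` with `g(x)x^{-(σ₁+1)}` integrable, and suppose every alternating chain of `g` in `(1, X]`
has length `≤ D·log X + B` (`X ≥ 1`) — sign-change upper density `≤ D`. Let `Φ` continue
`Landau.mellinIoi g` from `{σ₁ < re}` (`θ ≤ σ₁`), meromorphic on `{θ − b < re}` (`b > 0`) and
holomorphic on `{θ < re} ∪ {θ − η < re, |im| < πD + η}` (`η > 0`). Then `mellinIoi g` has a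
holomorphic continuation to a half-plane `{θ − ε < re}` with `ε > 0` — otherwise Theorem B with
`Γ = πD + η` would give `limsup W(y)/log y ≥ D + η/π > D`. [cite: Grosswald1967, §4 Theorem B, pp. 4–5 (contrapositive reading)] -/
theorem Grosswald1967_thmB.exists_holomorphic_extension_of_chain_bound (hB : Grosswald1967_thmB)
    (g : ℝ → ℝ) (σ₁ θ b η D B : ℝ)
    (hint : IntegrableOn (fun x : ℝ => g x * x ^ (-(σ₁ + 1))) (Ioi 1))
    (hchain : ∀ X : ℝ, 1 ≤ X → ∀ (n : ℕ) (x : Fin (n + 1) → ℝ), StrictMono x →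
      (∀ i, x i ∈ Ioc 1 X) → (∀ i : Fin n, g (x i.castSucc) * g (x i.succ) < 0) →
      (n : ℝ) ≤ D * Real.log X + B)
    (hθ : θ ≤ σ₁) (hb : 0 < b) (hη : 0 < η) (Φ : ℂ → ℂ)
    (hmer : MeromorphicOn Φ {s : ℂ | θ - b < s.re})
    (hhol : DifferentiableOn ℂ Φ ({s : ℂ | θ < s.re} ∪ {s : ℂ | θ - η < s.re ∧ |s.im| < Real.pi * D + η}))
    (heq : EqOn Φ (Landau.mellinIoi g) {s : ℂ | σ₁ < s.re}) :
    ∃ ε : ℝ, 0 < ε ∧ ∃ Φ' : ℂ → ℂ, DifferentiableOn ℂ Φ' {s : ℂ | θ - ε < s.re} ∧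
      EqOn Φ' (Landau.mellinIoi g) {s : ℂ | σ₁ < s.re} := by
  by_contra hnot
  push Not at hnot
  -- `hnot : ∀ ε > 0, ∀ Φ', DifferentiableOn … → ¬ EqOn …` is Theorem B's "no larger half-plane"
  have hno : ∀ ε : ℝ, 0 < ε → ¬ ∃ Ψ : ℂ → ℂ, DifferentiableOn ℂ Ψ {s : ℂ | θ - ε < s.re} ∧
      EqOn Ψ (Landau.mellinIoi g) {s : ℂ | σ₁ < s.re} := by
    rintro ε hε ⟨Ψ, h1, h2⟩
    exact hnot ε hε Ψ h1 h2
  -- the degenerate case `πD + η ≤ 0` cannot occur with `η > 0` unless `D < 0`; handle `Γ ≤ 0` first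
  rcases le_or_gt (Real.pi * D + η) 0 with hΓ | hΓ
  · -- then `D < 0`, and a chain of length `0` at a large `X` already violates the bound
    have hD : D < 0 := by
      have : 0 < Real.pi := Real.pi_pos
      nlinarith
    -- choose `X` with `D * log X + B < 0`
    obtain ⟨X, hX1, hXB⟩ : ∃ X : ℝ, 1 < X ∧ D * Real.log X + B < 0 := by
      refine ⟨Real.exp ((|B| + 1) / (-D)), ?_, ?_⟩
      · exact Real.one_lt_exp_iff.2 (div_pos (by positivity) (by linarith))
      · have hD0 : D ≠ 0 := hD.ne
        rw [Real.log_exp, mul_div_assoc', show D * (|B| + 1) / -D = -(|B| + 1) by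
          rw [div_neg, mul_comm, mul_div_assoc, div_self hD0, mul_one]]
        linarith [le_abs_self B]
    have := hchain X hX1.le 0 (fun _ => X) (fun a b h => absurd h (by rw [Fin.lt_def]; omega))
      (fun _ => ⟨hX1, le_rfl⟩) (fun i => i.elim0)
    simp only [Nat.cast_zero] at this
    linarith
  -- main case: apply Theorem B with `Γ = πD + η`
  have h1 : DifferentiableOn ℂ Φ {s : ℂ | θ < s.re} := hhol.mono subset_union_left
  have h2 : DifferentiableOn ℂ Φ {s : ℂ | θ - η < s.re ∧ |s.im| < Real.pi * D + η} :=
    hhol.mono subset_union_right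
  have hmain := hB g σ₁ θ b Φ hint hθ hb hmer h1 heq hno (Real.pi * D + η) η hΓ hη h2
  -- a density `c` with `D < c < D + η/π`
  set c := D + η / (2 * Real.pi) with hc_def
  have hπ : 0 < Real.pi := Real.pi_pos
  have hc1 : c < (Real.pi * D + η) / Real.pi := by
    rw [hc_def, lt_div_iff₀ hπ]
    have : (D + η / (2 * Real.pi)) * Real.pi = Real.pi * D + η / 2 := by field_simp
    rw [this]; linarith
  have hcD : D < c := by rw [hc_def]; linarith [div_pos hη (by positivity : (0:ℝ) < 2 * Real.pi)]
  -- beyond `y₀`, `c log y > D log y + B`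
  set y₀ := max 1 (Real.exp ((|B| + 1) / (c - D))) with hy₀_def
  obtain ⟨y, hy, n, hchainy, hn⟩ := hmain c hc1 y₀
  obtain ⟨x, hx, hmem, hsign⟩ := hchainy
  have hy1 : 1 ≤ y := le_trans (le_max_left _ _) hy
  have hbound := hchain y hy1 n x hx hmem hsign
  have hlog : (|B| + 1) / (c - D) ≤ Real.log y := by
    have h3 : Real.exp ((|B| + 1) / (c - D)) ≤ y := le_trans (le_max_right _ _) hy
    have := Real.log_le_log (Real.exp_pos _) h3
    rwa [Real.log_exp] at this
  have h4 : |B| + 1 ≤ (c - D) * Real.log y := by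
    rwa [div_le_iff₀ (by linarith), mul_comm] at hlog
  have h5 : B ≤ |B| := le_abs_self B
  nlinarith

end PolyaSignChanges

end Literature.NumberTheory.LFunctions

end
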